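import Literature.Probability.LatticeModels.MTP2FKG
import Mathlib.MeasureTheory.Constructions.Pi
import Mathlib.MeasureTheory.Integral.Lebesgue.Map
import Mathlib.MeasureTheory.Integral.Lebesgue.Countable
import Mathlib.MeasureTheory.Measure.Prod
import HarnessLib

/-!
# The continuous four functions theorem (Karlin–Rinott 1980, Thm. 2.1) and FKG for MTP₂ densities
# (Thm. 2.3): discharge of `KarlinRinott1980_thm_2_3`

CITATION HEADER.  Source: S. Karlin, Y. Rinott, *Classes of orderings of measures and related
correlation inequalities. I. Multivariate totally positive distributions*, J. Multivariate Anal. **10**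
(1980) 467–498 [KarlinRinott1980]; held text `paper:doi-10-1016-0047-259x-80-90065-2`, pp. 4–5 of
the materialised text (= pp. 470–472), read 2026-08-20.  Verbatim (§2): "THEOREM 2.1. Let `f₁, f₂,
f₃, f₄` be nonnegative functions on `𝒳 = ∏ 𝒳ᵢ` satisfying for all `x, y ∈ 𝒳`:
`f₁(x) f₂(y) ≤ f₃(x ∨ y) f₄(x ∧ y)` (2.1).  Then `∫ f₁ dσ ∫ f₂ dσ ≤ ∫ f₃ dσ ∫ f₄ dσ` (2.2).
Proof. We proceed by induction on the dimension of `𝒳` … the comparison of (2.2) for `n = 1` will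
follow provided we confirm the inequality
`∫∫_{x<y} [f₁(x)f₂(y) + f₁(y)f₂(x)] dx dy ≤ ∫∫_{x<y} [f₃(y)f₄(x) + f₃(x)f₄(y)] dx dy` … In order to
advance the induction step we next prove that if `f₁, f₂, f₃, f₄` satisfy (2.1), then the (marginals)
functions `φⱼ(x) = ∫ fⱼ(x, 𝓍) dσ_n(𝓍)`, `j = 1,2,3,4`, … continue to satisfy (2.1)"; and "THEOREM 2.3
(Sarkar; Fortuin, Ginibre and Kasteleyn; Preston). Let `f` be a probability density with respect to
`dσ(x)` on `𝒳` satisfying `f(x ∨ y) f(x ∧ y) ≥ f(x) f(y)`. Then for any pair of increasing (or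
decreasing) functions `φ` and `ψ` on `𝒳` we have `∫ φψ f dσ ≥ (∫ φ f dσ)(∫ ψ f dσ)` (2.12)", whose
printed proof reduces (2.12) to Thm. 2.1 with `f₁* = f φ`, `f₂* = f ψ`-type choices (p. 471, (2.8)–(2.10),
(2.13)) — the same reduction as Mathlib's finite `fkg` from `four_functions_theorem`.

## What is proved (theorems only; no definition, no named fact)

* `ennreal_two_by_two_step` — the `2 × 2` step of the proof of Thm. 2.1 in `[0, ∞]`
  (`ab ≤ AB, cd ≤ AB, ad ≤ AD, bc ≤ BC ⇒ ab + cd ≤ AB + CD`), the extended-real form needed because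
  marginals of `[0,∞]`-valued kernels are Lebesgue integrals (no junk values, no integrability needed).
* `fourFunctions_section_le`, `fourFunctions_marginal` — the marginal step of the proof of Thm. 2.1 for
  one coordinate of `ℝ^{n+1}`: if `f₁,…,f₄ : ℝ^{n+1} → [0,∞]` satisfy (2.1) then so do their Lebesgue
  marginals `y ↦ ∫⁻ fⱼ(xᵢ := t, y) dν(t)` for any s-finite `ν` (symmetrised double integral).
* `lintegral_four_functions_fin`, `lintegral_four_functions` — **Thm. 2.1** for `∏ᵢ μᵢ` on `ℝ^ι`,
  `ι` finite, `μᵢ` σ-finite, measurable `fⱼ : ℝ^ι → [0,∞]`: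
  `(∫⁻ f₁)(∫⁻ f₂) ≤ (∫⁻ f₃)(∫⁻ f₄)`.  (Printed for products of totally ordered measure spaces with
  nonnegative real `fⱼ` and tacit integrability; rendered for `𝒳ᵢ = ℝ` with `[0,∞]`-valued `fⱼ`, which
  needs no integrability at all — hypotheses only weakened.)
* `lmarginal_fkgCondition`, `KarlinRinott1980_prop_3_2_lintegral` — **Prop. 3.2** in junk-free
  Lebesgue-integral form (marginals of `[0,∞]`-valued MTP₂ kernels / of `ofReal ∘ f` are MTP₂ at
  every pair of points, no integrability).
* `KarlinRinott1980_thm_2_3_holds : KarlinRinott1980_thm_2_3` — **Thm. 2.3** (FKG / positive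
  association for MTP₂ densities), the named fact of `MTP2FKG.lean`, DISCHARGED: shift `φ, ψ` to be
  nonnegative, apply Thm. 2.1 to `ofReal (φ f), ofReal (ψ f), ofReal (φ ψ f), ofReal f` (hypothesis (2.1)
  from monotonicity and MTP₂), convert back with `ofReal_integral_eq_lintegral_ofReal`.

Junk-value remark (cf. `not_KarlinRinott1980_prop_3_2` in `MTP2FKG.lean`): all marginals here are
Lebesgue integrals in `[0,∞]`, so a non-integrable section has the honest value `∞`, never `0`; this is
why Thm. 2.1 is proved for `[0,∞]`-valued functions first.
-/

noncomputable section

open MeasureTheory ENNReal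
open scoped NNReal

namespace Literature.Probability.LatticeModels

/-! ### The `2 × 2` step in `ℝ` and in `[0, ∞]` -/

/-- Real form of the `2 × 2` step (proof of Thm. 2.1). [cite: KarlinRinott1980, §2, proof of Thm. 2.1] -/
private theorem real_two_by_two_step {a b c d A B C D : ℝ} (ha : 0 ≤ a) (hb : 0 ≤ b) (hc : 0 ≤ c)
    (hd : 0 ≤ d) (hA : 0 ≤ A) (hB : 0 ≤ B) (hC : 0 ≤ C) (hD : 0 ≤ D) (h₁ : a * b ≤ A * B)
    (h₂ : c * d ≤ A * B) (h₃ : a * d ≤ A * D) (h₄ : b * c ≤ B * C) :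
    a * b + c * d ≤ A * B + C * D := by
  rcases (mul_nonneg hA hB).eq_or_lt with h0 | hpos
  · have hab : a * b = 0 := le_antisymm (h0 ▸ h₁) (mul_nonneg ha hb)
    have hcd : c * d = 0 := le_antisymm (h0 ▸ h₂) (mul_nonneg hc hd)
    rw [hab, hcd, ← h0]
    simpa using mul_nonneg hC hD
  · have k₁ : 0 ≤ (A * B - a * b) * (A * B - c * d) := mul_nonneg (sub_nonneg.2 h₁) (sub_nonneg.2 h₂)
    have k₂ : (a * d) * (b * c) ≤ (A * D) * (B * C) :=
      mul_le_mul h₃ h₄ (mul_nonneg hb hc) (mul_nonneg hA hD)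
    have k₃ : A * B * (a * b + c * d) ≤ A * B * (A * B + C * D) := by nlinarith [k₁, k₂]
    exact le_of_mul_le_mul_left k₃ hpos

/-- **The `2 × 2` step of the continuous four functions theorem, in `[0, ∞]`**: for extended
nonnegative reals with `ab ≤ AB`, `cd ≤ AB`, `ad ≤ AD`, `bc ≤ BC` one has `ab + cd ≤ AB + CD`
(the infinite cases by inspection, the finite case = the real step). [cite: KarlinRinott1980, §2, proof of Thm. 2.1] -/
theorem ennreal_two_by_two_step {a b c d A B C D : ℝ≥0∞} (h₁ : a * b ≤ A * B) (h₂ : c * d ≤ A * B)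
    (h₃ : a * d ≤ A * D) (h₄ : b * c ≤ B * C) : a * b + c * d ≤ A * B + C * D := by
  rcases eq_or_ne (A * B) ⊤ with hAB | hAB
  · rw [hAB, top_add]; exact le_top
  rcases eq_or_ne (C * D) ⊤ with hCD | hCD
  · rw [hCD, add_top]; exact le_top
  have hab : a * b ≠ ⊤ := ne_top_of_le_ne_top hAB h₁
  have hcd : c * d ≠ ⊤ := ne_top_of_le_ne_top hAB h₂
  have habAB : a * b ≤ A * B + C * D := h₁.trans le_self_add
  have hcdAB : c * d ≤ A * B + C * D := h₂.trans le_self_add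
  by_cases ha : a = ⊤
  · have hb : b = 0 := by
      by_contra hb
      exact hab (by rw [ha, ENNReal.top_mul hb])
    rw [hb, mul_zero, zero_add]; exact hcdAB
  by_cases hb : b = ⊤
  · have ha0 : a = 0 := by
      by_contra h0
      exact hab (by rw [hb, ENNReal.mul_top h0])
    rw [ha0, zero_mul, zero_add]; exact hcdAB
  by_cases hc : c = ⊤
  · have hd : d = 0 := by
      by_contra hd
      exact hcd (by rw [hc, ENNReal.top_mul hd])
    rw [hd, mul_zero, add_zero]; exact habAB
  by_cases hd : d = ⊤
  · have hc0 : c = 0 := by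
      by_contra h0
      exact hcd (by rw [hd, ENNReal.mul_top h0])
    rw [hc0, zero_mul, add_zero]; exact habAB
  by_cases hA : A = ⊤
  · have hB : B = 0 := by
      by_contra hB
      exact hAB (by rw [hA, ENNReal.top_mul hB])
    rw [hB, mul_zero] at h₁ h₂
    rw [le_zero_iff.1 h₁, le_zero_iff.1 h₂, zero_add]; exact bot_le
  by_cases hB : B = ⊤
  · have hA0 : A = 0 := by
      by_contra h0
      exact hAB (by rw [hB, ENNReal.mul_top h0])
    rw [hA0, zero_mul] at h₁ h₂
    rw [le_zero_iff.1 h₁, le_zero_iff.1 h₂, zero_add]; exact bot_le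
  by_cases hC : C = ⊤
  · have hD : D = 0 := by
      by_contra hD
      exact hCD (by rw [hC, ENNReal.top_mul hD])
    rw [hD, mul_zero] at h₃
    rcases mul_eq_zero.1 (le_zero_iff.1 h₃) with ha0 | hd0
    · rw [ha0, zero_mul, zero_add]; exact hcdAB
    · rw [hd0, mul_zero, add_zero]; exact habAB
  by_cases hD : D = ⊤
  · have hC0 : C = 0 := by
      by_contra h0
      exact hCD (by rw [hD, ENNReal.mul_top h0])
    rw [hC0, mul_zero] at h₄
    rcases mul_eq_zero.1 (le_zero_iff.1 h₄) with hb0 | hc0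
    · rw [hb0, mul_zero, zero_add]; exact hcdAB
    · rw [hc0, zero_mul, add_zero]; exact habAB
  -- all eight quantities are finite: pass to `ℝ≥0` and then to `ℝ`
  lift a to ℝ≥0 using ha
  lift b to ℝ≥0 using hb
  lift c to ℝ≥0 using hc
  lift d to ℝ≥0 using hd
  lift A to ℝ≥0 using hA
  lift B to ℝ≥0 using hB
  lift C to ℝ≥0 using hC
  lift D to ℝ≥0 using hD
  have g₁ : (a : ℝ) * b ≤ A * B := by exact_mod_cast h₁
  have g₂ : (c : ℝ) * d ≤ A * B := by exact_mod_cast h₂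
  have g₃ : (a : ℝ) * d ≤ A * D := by exact_mod_cast h₃
  have g₄ : (b : ℝ) * c ≤ B * C := by exact_mod_cast h₄
  have key : (a : ℝ) * b + c * d ≤ A * B + C * D :=
    real_two_by_two_step a.2 b.2 c.2 d.2 A.2 B.2 C.2 D.2 g₁ g₂ g₃ g₄
  exact_mod_cast key

/-! ### The marginal step (one coordinate of `ℝ^{n+1}`) -/

section Marginal

variable {n : ℕ}

/-- `insertNth` commutes with the coordinatewise `⊔` (non-dependent real tuples). [folklore] -/
private theorem insertNth_sup (i : Fin (n + 1)) (t s : ℝ) (y z : Fin n → ℝ) :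
    (Fin.insertNth (α := fun _ => ℝ) i t y) ⊔ (Fin.insertNth (α := fun _ => ℝ) i s z) =
      Fin.insertNth (α := fun _ => ℝ) i (t ⊔ s) (y ⊔ z) := by
  have h := Fin.insertNth_binop (α := fun _ => ℝ) (fun _ a b => a ⊔ b) i t s y z
  have e : (Fin.insertNth (α := fun _ => ℝ) i t y) ⊔ (Fin.insertNth (α := fun _ => ℝ) i s z) =
      fun j => (Fin.insertNth (α := fun _ => ℝ) i t y j) ⊔ (Fin.insertNth (α := fun _ => ℝ) i s z j) :=
    rfl
  rw [e, ← h]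
  rfl

/-- `insertNth` commutes with the coordinatewise `⊓` (non-dependent real tuples). [folklore] -/
private theorem insertNth_inf (i : Fin (n + 1)) (t s : ℝ) (y z : Fin n → ℝ) :
    (Fin.insertNth (α := fun _ => ℝ) i t y) ⊓ (Fin.insertNth (α := fun _ => ℝ) i s z) =
      Fin.insertNth (α := fun _ => ℝ) i (t ⊓ s) (y ⊓ z) := by
  have h := Fin.insertNth_binop (α := fun _ => ℝ) (fun _ a b => a ⊓ b) i t s y z
  have e : (Fin.insertNth (α := fun _ => ℝ) i t y) ⊓ (Fin.insertNth (α := fun _ => ℝ) i s z) =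
      fun j => (Fin.insertNth (α := fun _ => ℝ) i t y j) ⊓ (Fin.insertNth (α := fun _ => ℝ) i s z j) :=
    rfl
  rw [e, ← h]
  rfl

variable {f₁ f₂ f₃ f₄ : (Fin (n + 1) → ℝ) → ℝ≥0∞}

/-- **Pointwise form of the marginal step of Thm. 2.1**: if `f₁(x)f₂(y) ≤ f₃(x ∨ y)f₄(x ∧ y)` on
`ℝ^{n+1}`, then for base points `y, z ∈ ℝⁿ` and heights `t, s`,
`f₁(t,y)f₂(s,z) + f₁(s,y)f₂(t,z) ≤ f₃(t,y∨z)f₄(s,y∧z) + f₃(s,y∨z)f₄(t,y∧z)` (coordinate `i`).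
[cite: KarlinRinott1980, §2, proof of Thm. 2.1 (the n = 1 comparison and the marginal step)] -/
theorem fourFunctions_section_le (h : ∀ x y, f₁ x * f₂ y ≤ f₃ (x ⊔ y) * f₄ (x ⊓ y))
    (i : Fin (n + 1)) (y z : Fin n → ℝ) (t s : ℝ) :
    f₁ (Fin.insertNth i t y) * f₂ (Fin.insertNth i s z) +
        f₁ (Fin.insertNth i s y) * f₂ (Fin.insertNth i t z) ≤
      f₃ (Fin.insertNth i t (y ⊔ z)) * f₄ (Fin.insertNth i s (y ⊓ z)) +
        f₃ (Fin.insertNth i s (y ⊔ z)) * f₄ (Fin.insertNth i t (y ⊓ z)) := by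
  wlog hst : s ≤ t generalizing t s
  · have h' := this s t (le_of_not_ge hst)
    rw [add_comm] at h'
    rw [add_comm (f₃ _ * f₄ _)]
    exact h'
  have ets : t ⊔ s = t := sup_eq_left.2 hst
  have est : s ⊔ t = t := sup_eq_right.2 hst
  have its : t ⊓ s = s := inf_eq_right.2 hst
  have ist : s ⊓ t = s := inf_eq_left.2 hst
  have k₁ := h (Fin.insertNth i t y) (Fin.insertNth i s z)
  have k₂ := h (Fin.insertNth i s y) (Fin.insertNth i t z)
  have k₃ := h (Fin.insertNth i t y) (Fin.insertNth i t z)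
  have k₄ := h (Fin.insertNth i s y) (Fin.insertNth i s z)
  rw [insertNth_sup, insertNth_inf] at k₁ k₂ k₃ k₄
  rw [ets, its] at k₁
  rw [est, ist] at k₂
  rw [sup_idem, inf_idem] at k₃ k₄
  exact ennreal_two_by_two_step k₁ k₂ k₃ (by simpa [mul_comm] using k₄)

/-- Sections of a measurable function on `ℝ^{n+1}` along `insertNth` are jointly measurable in
`(t, y)`. [folklore] -/
private theorem measurable_comp_insertNth {g : (Fin (n + 1) → ℝ) → ℝ≥0∞} (hg : Measurable g)
    (i : Fin (n + 1)) : Measurable fun p : ℝ × (Fin n → ℝ) => g (Fin.insertNth i p.1 p.2) := by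
  have hm : Measurable fun p : ℝ × (Fin n → ℝ) =>
      (MeasurableEquiv.piFinSuccAbove (fun _ => ℝ) i).symm p :=
    (MeasurableEquiv.piFinSuccAbove (fun _ => ℝ) i).symm.measurable
  have e : (fun p : ℝ × (Fin n → ℝ) => g (Fin.insertNth i p.1 p.2)) =
      fun p => g ((MeasurableEquiv.piFinSuccAbove (fun _ => ℝ) i).symm p) := by
    funext p
    simp [MeasurableEquiv.piFinSuccAbove_symm_apply, Fin.insertNthEquiv]
  rw [e]
  exact hg.comp hm

/-- The Lebesgue marginal `y ↦ ∫⁻ g(xᵢ := t, y) dν(t)` of a measurable `g` is measurable. [folklore] -/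
private theorem measurable_lmarginal (ν : Measure ℝ) [SFinite ν]
    {g : (Fin (n + 1) → ℝ) → ℝ≥0∞} (hg : Measurable g) (i : Fin (n + 1)) :
    Measurable fun y : Fin n → ℝ => ∫⁻ t, g (Fin.insertNth i t y) ∂ν :=
  (measurable_comp_insertNth hg i).lintegral_prod_left'

/-- **The marginal step of Thm. 2.1** ("if `f₁, f₂, f₃, f₄` satisfy (2.1), then the marginals …
continue to satisfy (2.1)"), for Lebesgue marginals in `[0,∞]` of measurable `fⱼ` over one coordinate
and any s-finite `ν`: symmetrised double integral of `fourFunctions_section_le`.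
[cite: KarlinRinott1980, §2, proof of Thm. 2.1] -/
theorem fourFunctions_marginal (ν : Measure ℝ) [SFinite ν] (hm₁ : Measurable f₁) (hm₂ : Measurable f₂)
    (hm₃ : Measurable f₃) (hm₄ : Measurable f₄)
    (h : ∀ x y, f₁ x * f₂ y ≤ f₃ (x ⊔ y) * f₄ (x ⊓ y)) (i : Fin (n + 1)) (y z : Fin n → ℝ) :
    (∫⁻ t, f₁ (Fin.insertNth i t y) ∂ν) * (∫⁻ t, f₂ (Fin.insertNth i t z) ∂ν) ≤
      (∫⁻ t, f₃ (Fin.insertNth i t (y ⊔ z)) ∂ν) * (∫⁻ t, f₄ (Fin.insertNth i t (y ⊓ z)) ∂ν) := by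
  -- sections as measurable functions of `t`
  have sec : ∀ {g : (Fin (n + 1) → ℝ) → ℝ≥0∞}, Measurable g → ∀ w : Fin n → ℝ,
      Measurable fun t : ℝ => g (Fin.insertNth i t w) :=
    fun hg w => (measurable_comp_insertNth hg i).comp (measurable_id.prodMk measurable_const)
  set F₁ : ℝ → ℝ≥0∞ := fun t => f₁ (Fin.insertNth i t y)
  set F₂ : ℝ → ℝ≥0∞ := fun t => f₂ (Fin.insertNth i t z)
  set F₃ : ℝ → ℝ≥0∞ := fun t => f₃ (Fin.insertNth i t (y ⊔ z))
  set F₄ : ℝ → ℝ≥0∞ := fun t => f₄ (Fin.insertNth i t (y ⊓ z))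
  have mF₁ : Measurable F₁ := sec hm₁ y
  have mF₂ : Measurable F₂ := sec hm₂ z
  have mF₃ : Measurable F₃ := sec hm₃ _
  have mF₄ : Measurable F₄ := sec hm₄ _
  -- product integrals and their swapped forms
  have hprod : ∀ {G H : ℝ → ℝ≥0∞}, Measurable G → Measurable H →
      (∫⁻ t, G t ∂ν) * (∫⁻ t, H t ∂ν) = ∫⁻ p : ℝ × ℝ, G p.1 * H p.2 ∂ν.prod ν :=
    fun hG hH => (lintegral_prod_mul hG.aemeasurable hH.aemeasurable).symm
  have hswap : ∀ (G H : ℝ → ℝ≥0∞),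
      ∫⁻ p : ℝ × ℝ, G p.2 * H p.1 ∂ν.prod ν = ∫⁻ p : ℝ × ℝ, G p.1 * H p.2 ∂ν.prod ν := by
    intro G H
    have := lintegral_prod_swap (μ := ν) (ν := ν) (fun p : ℝ × ℝ => G p.1 * H p.2)
    simpa using this
  have m12 : Measurable fun p : ℝ × ℝ => F₁ p.1 * F₂ p.2 :=
    (mF₁.comp measurable_fst).mul (mF₂.comp measurable_snd)
  have m34 : Measurable fun p : ℝ × ℝ => F₃ p.1 * F₄ p.2 :=
    (mF₃.comp measurable_fst).mul (mF₄.comp measurable_snd)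
  have lhs : 2 * ((∫⁻ t, F₁ t ∂ν) * (∫⁻ t, F₂ t ∂ν)) =
      ∫⁻ p : ℝ × ℝ, (F₁ p.1 * F₂ p.2 + F₁ p.2 * F₂ p.1) ∂ν.prod ν := by
    rw [lintegral_add_left m12, hswap, ← hprod mF₁ mF₂, two_mul]
  have rhs : 2 * ((∫⁻ t, F₃ t ∂ν) * (∫⁻ t, F₄ t ∂ν)) =
      ∫⁻ p : ℝ × ℝ, (F₃ p.1 * F₄ p.2 + F₃ p.2 * F₄ p.1) ∂ν.prod ν := by
    rw [lintegral_add_left m34, hswap, ← hprod mF₃ mF₄, two_mul]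
  have hmono : ∫⁻ p : ℝ × ℝ, (F₁ p.1 * F₂ p.2 + F₁ p.2 * F₂ p.1) ∂ν.prod ν ≤
      ∫⁻ p : ℝ × ℝ, (F₃ p.1 * F₄ p.2 + F₃ p.2 * F₄ p.1) ∂ν.prod ν :=
    lintegral_mono fun p => fourFunctions_section_le h i y z p.1 p.2
  have key : 2 * ((∫⁻ t, F₁ t ∂ν) * (∫⁻ t, F₂ t ∂ν)) ≤ 2 * ((∫⁻ t, F₃ t ∂ν) * (∫⁻ t, F₄ t ∂ν)) := by
    rw [lhs, rhs]; exact hmono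
  exact (ENNReal.mul_le_mul_iff_right two_ne_zero ENNReal.ofNat_ne_top).1 key

end Marginal

/-! ### Thm. 2.1 (continuous four functions theorem) for Lebesgue integrals -/

/-- **Karlin–Rinott 1980, Thm. 2.1 (continuous Ahlswede–Daykin four functions theorem), on `ℝⁿ`**:
for σ-finite `μ₀,…,μ_{n−1}` on `ℝ` and measurable `f₁, f₂, f₃, f₄ : ℝⁿ → [0,∞]` with
`f₁(x) f₂(y) ≤ f₃(x ∨ y) f₄(x ∧ y)` for all `x, y`,
`(∫⁻ f₁ d∏μᵢ)(∫⁻ f₂ d∏μᵢ) ≤ (∫⁻ f₃ d∏μᵢ)(∫⁻ f₄ d∏μᵢ)`.  Induction on `n` exactly as printed: the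
marginals over one coordinate satisfy (2.1) again (`fourFunctions_marginal`).
[cite: KarlinRinott1980, Thm. 2.1] -/
theorem lintegral_four_functions_fin :
    ∀ (n : ℕ) (μ : Fin n → Measure ℝ) [∀ i, SigmaFinite (μ i)] (f₁ f₂ f₃ f₄ : (Fin n → ℝ) → ℝ≥0∞),
      Measurable f₁ → Measurable f₂ → Measurable f₃ → Measurable f₄ →
      (∀ x y, f₁ x * f₂ y ≤ f₃ (x ⊔ y) * f₄ (x ⊓ y)) →
        (∫⁻ x, f₁ x ∂Measure.pi μ) * (∫⁻ x, f₂ x ∂Measure.pi μ) ≤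
          (∫⁻ x, f₃ x ∂Measure.pi μ) * (∫⁻ x, f₄ x ∂Measure.pi μ)
  | 0, μ, _, f₁, f₂, f₃, f₄, hm₁, hm₂, hm₃, hm₄, h => by
    let x₀ : Fin 0 → ℝ := isEmptyElim
    rw [Measure.pi_of_empty μ x₀, lintegral_dirac' _ hm₁, lintegral_dirac' _ hm₂,
      lintegral_dirac' _ hm₃, lintegral_dirac' _ hm₄]
    simpa using h x₀ x₀
  | n + 1, μ, _, f₁, f₂, f₃, f₄, hm₁, hm₂, hm₃, hm₄, h => by
    -- split off coordinate `0`: `ℝ^{n+1} ≃ ℝ × ℝⁿ`, `∏μ ≃ μ₀ ⊗ ∏_{j ≥ 1} μ_j`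
    set ν := μ 0 with hν
    set μ' : Fin n → Measure ℝ := fun j => μ (Fin.succAbove 0 j) with hμ'
    have hmp := measurePreserving_piFinSuccAbove μ 0
    -- `∫⁻ f_j d∏μ = ∫⁻ y, Φ_j y d∏μ'` with `Φ_j y = ∫⁻ t, f_j(x₀ := t, y) dν`
    have split : ∀ {g : (Fin (n + 1) → ℝ) → ℝ≥0∞}, Measurable g →
        ∫⁻ x, g x ∂Measure.pi μ = ∫⁻ y, (∫⁻ t, g (Fin.insertNth 0 t y) ∂ν) ∂Measure.pi μ' := by
      intro g hg
      have h1 := hmp.symm _ |>.lintegral_comp_emb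
        (MeasurableEquiv.piFinSuccAbove (fun _ => ℝ) 0).symm.measurableEmbedding g
      rw [← h1]
      have e : (fun p : ℝ × (Fin n → ℝ) => g ((MeasurableEquiv.piFinSuccAbove (fun _ => ℝ) 0).symm p))
          = fun p => g (Fin.insertNth 0 p.1 p.2) := by
        funext p
        simp [MeasurableEquiv.piFinSuccAbove_symm_apply, Fin.insertNthEquiv]
      rw [e, lintegral_prod_symm _ (measurable_comp_insertNth hg 0).aemeasurable]
    rw [split hm₁, split hm₂, split hm₃, split hm₄]
    -- induction hypothesis for the marginals
    refine lintegral_four_functions_fin n μ' _ _ _ _ (measurable_lmarginal ν hm₁ 0)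
      (measurable_lmarginal ν hm₂ 0) (measurable_lmarginal ν hm₃ 0) (measurable_lmarginal ν hm₄ 0)
      fun y z => ?_
    exact fourFunctions_marginal ν hm₁ hm₂ hm₃ hm₄ h 0 y z

/-- A coordinate relabelling `ℝ^ι ≃ ℝ^{ι'}` commutes with the coordinatewise lattice operations.
[folklore] -/
private theorem piCongrLeft_sup {ι ι' : Type*} (e : ι' ≃ ι) (x y : ι' → ℝ) :
    MeasurableEquiv.piCongrLeft (fun _ => ℝ) e (x ⊔ y) =
      MeasurableEquiv.piCongrLeft (fun _ => ℝ) e x ⊔ MeasurableEquiv.piCongrLeft (fun _ => ℝ) e y := by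
  funext b
  simp only [MeasurableEquiv.coe_piCongrLeft, Equiv.piCongrLeft_apply_eq_cast, cast_eq, Pi.sup_apply]

/-- As `piCongrLeft_sup`, for `⊓`. [folklore] -/
private theorem piCongrLeft_inf {ι ι' : Type*} (e : ι' ≃ ι) (x y : ι' → ℝ) :
    MeasurableEquiv.piCongrLeft (fun _ => ℝ) e (x ⊓ y) =
      MeasurableEquiv.piCongrLeft (fun _ => ℝ) e x ⊓ MeasurableEquiv.piCongrLeft (fun _ => ℝ) e y := by
  funext b
  simp only [MeasurableEquiv.coe_piCongrLeft, Equiv.piCongrLeft_apply_eq_cast, cast_eq, Pi.inf_apply]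

/-- **Karlin–Rinott 1980, Thm. 2.1, for a general finite index type** (relabelling `ι ≃ Fin n`).
[cite: KarlinRinott1980, Thm. 2.1] -/
theorem lintegral_four_functions {ι : Type*} [Fintype ι] (μ : ι → Measure ℝ)
    [∀ i, SigmaFinite (μ i)] (f₁ f₂ f₃ f₄ : (ι → ℝ) → ℝ≥0∞) (hm₁ : Measurable f₁)
    (hm₂ : Measurable f₂) (hm₃ : Measurable f₃) (hm₄ : Measurable f₄)
    (h : ∀ x y, f₁ x * f₂ y ≤ f₃ (x ⊔ y) * f₄ (x ⊓ y)) :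
    (∫⁻ x, f₁ x ∂Measure.pi μ) * (∫⁻ x, f₂ x ∂Measure.pi μ) ≤
      (∫⁻ x, f₃ x ∂Measure.pi μ) * (∫⁻ x, f₄ x ∂Measure.pi μ) := by
  classical
  set e := (Fintype.equivFin ι).symm with he
  set E := MeasurableEquiv.piCongrLeft (fun _ => ℝ) e with hE
  have hmp : MeasurePreserving E (Measure.pi fun k => μ (e k)) (Measure.pi μ) :=
    measurePreserving_piCongrLeft μ e
  have tr : ∀ g : (ι → ℝ) → ℝ≥0∞, ∫⁻ x, g x ∂Measure.pi μ = ∫⁻ a, g (E a) ∂Measure.pi fun k => μ (e k) :=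
    fun g => (hmp.lintegral_comp_emb E.measurableEmbedding g).symm
  rw [tr f₁, tr f₂, tr f₃, tr f₄]
  have h' : ∀ x y : Fin (Fintype.card ι) → ℝ,
      f₁ (E x) * f₂ (E y) ≤ f₃ (E (x ⊔ y)) * f₄ (E (x ⊓ y)) := fun x y => by
    rw [piCongrLeft_sup, piCongrLeft_inf]
    exact h _ _
  exact lintegral_four_functions_fin (Fintype.card ι) (fun k => μ (e k)) (fun a => f₁ (E a))
    (fun a => f₂ (E a)) (fun a => f₃ (E a)) (fun a => f₄ (E a)) (hm₁.comp E.measurable)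
    (hm₂.comp E.measurable) (hm₃.comp E.measurable) (hm₄.comp E.measurable) h'

/-! ### Thm. 2.3: FKG for MTP₂ densities — discharge of the named fact -/

/-- **Karlin–Rinott 1980, Thm. 2.3 (Sarkar; Fortuin–Kasteleyn–Ginibre; Preston): FKG for MTP₂
densities with respect to a product of σ-finite measures on `ℝ^ι` — the named fact
`KarlinRinott1980_thm_2_3` DISCHARGED.**  Proof as printed ((2.8)–(2.13): reduction to Thm. 2.1):
after adding constants so that `φ, ψ ≥ 0`, the four functions `φf, ψf, φψf, f` (as `[0,∞]`-valued)
satisfy (2.1) by monotonicity and MTP₂, and Thm. 2.1 gives `(∫φf)(∫ψf) ≤ (∫φψf)(∫f) = ∫φψf`.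
[cite: KarlinRinott1980, Thm. 2.3 (2.12)] -/
theorem KarlinRinott1980_thm_2_3_holds : KarlinRinott1980_thm_2_3 := by
  intro ι _ μ _ f φ ψ hfm hf0 hf1 hf hφm hψm hφ hψ hφb hψb
  obtain ⟨Cφ, hCφ⟩ := hφb
  obtain ⟨Cψ, hCψ⟩ := hψb
  set P := Measure.pi μ with hP
  have hfi : Integrable f P := Integrable.of_integral_ne_zero (by rw [hf1]; exact one_ne_zero)
  -- shifted nonnegative monotone functions
  set φ' : (ι → ℝ) → ℝ := fun x => φ x + Cφ with hφ'
  set ψ' : (ι → ℝ) → ℝ := fun x => ψ x + Cψ with hψ'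
  have hφ'0 : ∀ x, 0 ≤ φ' x := fun x => by
    have := (abs_le.1 (hCφ x)).1
    simp only [hφ']; linarith
  have hψ'0 : ∀ x, 0 ≤ ψ' x := fun x => by
    have := (abs_le.1 (hCψ x)).1
    simp only [hψ']; linarith
  have hφ'm : Monotone φ' := fun x y hxy => by simpa [hφ'] using hφ hxy
  have hψ'm : Monotone ψ' := fun x y hxy => by simpa [hψ'] using hψ hxy
  have hφ'meas : Measurable φ' := hφm.add_const _
  have hψ'meas : Measurable ψ' := hψm.add_const _
  have hφ'b : ∀ x, ‖φ' x‖ ≤ 2 * Cφ := fun x => by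
    have h1 := abs_le.1 (hCφ x)
    have h2 : 0 ≤ Cφ := (abs_nonneg _).trans (hCφ x)
    rw [Real.norm_eq_abs]
    show |φ x + Cφ| ≤ 2 * Cφ
    rw [abs_le]
    constructor <;> linarith [h1.1, h1.2]
  have hψ'b : ∀ x, ‖ψ' x‖ ≤ 2 * Cψ := fun x => by
    have h1 := abs_le.1 (hCψ x)
    have h2 : 0 ≤ Cψ := (abs_nonneg _).trans (hCψ x)
    rw [Real.norm_eq_abs]
    show |ψ x + Cψ| ≤ 2 * Cψ
    rw [abs_le]
    constructor <;> linarith [h1.1, h1.2]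
  -- integrability of the real integrands
  have iφf : Integrable (fun x => φ' x * f x) P :=
    hfi.bdd_mul hφ'meas.aestronglyMeasurable (Filter.Eventually.of_forall hφ'b)
  have iψf : Integrable (fun x => ψ' x * f x) P :=
    hfi.bdd_mul hψ'meas.aestronglyMeasurable (Filter.Eventually.of_forall hψ'b)
  have iφψf : Integrable (fun x => φ' x * (ψ' x * f x)) P :=
    iψf.bdd_mul hφ'meas.aestronglyMeasurable (Filter.Eventually.of_forall hφ'b)
  -- the four `[0,∞]`-valued functions
  have AD := lintegral_four_functions μ (fun x => ENNReal.ofReal (φ' x * f x))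
    (fun x => ENNReal.ofReal (ψ' x * f x)) (fun x => ENNReal.ofReal (φ' x * (ψ' x * f x)))
    (fun x => ENNReal.ofReal (f x)) (hφ'meas.mul hfm).ennreal_ofReal (hψ'meas.mul hfm).ennreal_ofReal
    (hφ'meas.mul (hψ'meas.mul hfm)).ennreal_ofReal hfm.ennreal_ofReal (fun x y => by
      rw [← ENNReal.ofReal_mul (mul_nonneg (hφ'0 x) (hf0 x)),
        ← ENNReal.ofReal_mul (mul_nonneg (hφ'0 _) (mul_nonneg (hψ'0 _) (hf0 _)))]
      apply ENNReal.ofReal_le_ofReal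
      have k1 : φ' x ≤ φ' (x ⊔ y) := hφ'm le_sup_left
      have k2 : ψ' y ≤ ψ' (x ⊔ y) := hψ'm le_sup_right
      have k3 : f x * f y ≤ f (x ⊔ y) * f (x ⊓ y) := hf x y
      calc φ' x * f x * (ψ' y * f y) = (φ' x * ψ' y) * (f x * f y) := by ring
        _ ≤ (φ' (x ⊔ y) * ψ' (x ⊔ y)) * (f (x ⊔ y) * f (x ⊓ y)) :=
            mul_le_mul (mul_le_mul k1 k2 (hψ'0 _) (hφ'0 _)) k3 (mul_nonneg (hf0 _) (hf0 _))
              (mul_nonneg (hφ'0 _) (hψ'0 _))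
        _ = φ' (x ⊔ y) * (ψ' (x ⊔ y) * f (x ⊔ y)) * f (x ⊓ y) := by ring)
  -- back to real integrals
  rw [← ofReal_integral_eq_lintegral_ofReal iφf (Filter.Eventually.of_forall fun x =>
        mul_nonneg (hφ'0 x) (hf0 x)),
    ← ofReal_integral_eq_lintegral_ofReal iψf (Filter.Eventually.of_forall fun x =>
        mul_nonneg (hψ'0 x) (hf0 x)),
    ← ofReal_integral_eq_lintegral_ofReal iφψf (Filter.Eventually.of_forall fun x =>
        mul_nonneg (hφ'0 x) (mul_nonneg (hψ'0 x) (hf0 x))),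
    ← ofReal_integral_eq_lintegral_ofReal hfi (Filter.Eventually.of_forall hf0), hf1,
    ENNReal.ofReal_one, mul_one,
    ← ENNReal.ofReal_mul (integral_nonneg fun x => mul_nonneg (hφ'0 x) (hf0 x)),
    ENNReal.ofReal_le_ofReal_iff (integral_nonneg fun x =>
        mul_nonneg (hφ'0 x) (mul_nonneg (hψ'0 x) (hf0 x)))] at AD
  -- AD : (∫ φ' f) * (∫ ψ' f) ≤ ∫ φ' ψ' f ; expand the shifts using `∫ f = 1`
  have iφf0 : Integrable (fun x => φ x * f x) P :=
    hfi.bdd_mul hφm.aestronglyMeasurable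
      (Filter.Eventually.of_forall fun x => by rw [Real.norm_eq_abs]; exact hCφ x)
  have iψf0 : Integrable (fun x => ψ x * f x) P :=
    hfi.bdd_mul hψm.aestronglyMeasurable
      (Filter.Eventually.of_forall fun x => by rw [Real.norm_eq_abs]; exact hCψ x)
  have iφψf0 : Integrable (fun x => φ x * (ψ x * f x)) P :=
    iψf0.bdd_mul hφm.aestronglyMeasurable
      (Filter.Eventually.of_forall fun x => by rw [Real.norm_eq_abs]; exact hCφ x)
  have e1 : ∫ x, φ' x * f x ∂P = (∫ x, φ x * f x ∂P) + Cφ := by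
    have : (fun x => φ' x * f x) = fun x => φ x * f x + Cφ * f x := by
      funext x; simp only [hφ']; ring
    rw [this, integral_add iφf0 (hfi.const_mul _), integral_const_mul, hf1, mul_one]
  have e2 : ∫ x, ψ' x * f x ∂P = (∫ x, ψ x * f x ∂P) + Cψ := by
    have : (fun x => ψ' x * f x) = fun x => ψ x * f x + Cψ * f x := by
      funext x; simp only [hψ']; ring
    rw [this, integral_add iψf0 (hfi.const_mul _), integral_const_mul, hf1, mul_one]
  have e3 : ∫ x, φ' x * (ψ' x * f x) ∂P =
      (∫ x, φ x * (ψ x * f x) ∂P) + Cψ * (∫ x, φ x * f x ∂P) + Cφ * (∫ x, ψ x * f x ∂P) + Cφ * Cψ := by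
    have : (fun x => φ' x * (ψ' x * f x)) =
        fun x => φ x * (ψ x * f x) + Cψ * (φ x * f x) + Cφ * (ψ x * f x) + Cφ * Cψ * f x := by
      funext x; simp only [hφ', hψ']; ring
    have i12 : Integrable (fun x => φ x * (ψ x * f x) + Cψ * (φ x * f x)) P :=
      iφψf0.add (iφf0.const_mul _)
    have i123 : Integrable (fun x => φ x * (ψ x * f x) + Cψ * (φ x * f x) + Cφ * (ψ x * f x)) P :=
      i12.add (iψf0.const_mul _)
    rw [this, integral_add i123 (hfi.const_mul _), integral_add i12 (iψf0.const_mul _),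
      integral_add iφψf0 (iφf0.const_mul _), integral_const_mul, integral_const_mul,
      integral_const_mul, hf1, mul_one]
  rw [e1, e2, e3] at AD
  have goal_eq : ∫ x, φ x * ψ x * f x ∂P = ∫ x, φ x * (ψ x * f x) ∂P := by
    congr 1; funext x; ring
  rw [goal_eq]
  nlinarith [AD]

/-! ### Prop. 3.2 without junk values: Lebesgue marginals of MTP₂ kernels are MTP₂ -/

/-- **Karlin–Rinott 1980, (1.15)–(1.16) / Prop. 3.2, junk-free form**: for an MTP₂ kernel
`g : ℝ^{n+1} → [0,∞]` (measurable, `g(x) g(y) ≤ g(x ∨ y) g(x ∧ y)`) and any s-finite `ν`, the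
Lebesgue marginal `Φ(y) = ∫⁻ g(xᵢ := t, y) dν(t) ∈ [0,∞]` satisfies `Φ(y)Φ(z) ≤ Φ(y ∨ z)Φ(y ∧ z)` for
ALL `y, z` — no integrability needed (a non-integrable section has the value `∞`, cf.
`not_KarlinRinott1980_prop_3_2`).  Special case `f₁ = f₂ = f₃ = f₄` of `fourFunctions_marginal`.
[cite: KarlinRinott1980, (1.15)–(1.16) and Prop. 3.2] -/
theorem lmarginal_fkgCondition {n : ℕ} (ν : Measure ℝ) [SFinite ν] {g : (Fin (n + 1) → ℝ) → ℝ≥0∞}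
    (hgm : Measurable g) (hg : ∀ x y, g x * g y ≤ g (x ⊔ y) * g (x ⊓ y)) (i : Fin (n + 1))
    (y z : Fin n → ℝ) :
    (∫⁻ t, g (Fin.insertNth i t y) ∂ν) * (∫⁻ t, g (Fin.insertNth i t z) ∂ν) ≤
      (∫⁻ t, g (Fin.insertNth i t (y ⊔ z)) ∂ν) * (∫⁻ t, g (Fin.insertNth i t (y ⊓ z)) ∂ν) :=
  fourFunctions_marginal ν hgm hgm hgm hgm hg i y z

/-- **Karlin–Rinott 1980, Prop. 3.2 for a real MTP₂ density, in Lebesgue-integral form**: for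
`f ≥ 0` measurable and MTP₂ on `ℝ^{n+1}`, the `[0,∞]`-valued marginal
`y ↦ ∫⁻ ofReal (f(xᵢ := t, y)) dν(t)` satisfies the MTP₂ inequality everywhere.  (The real-valued
Bochner rendering needs every section integrable: `KarlinRinott1980_prop_3_2_of_integrable`.)
[cite: KarlinRinott1980, (1.15)–(1.16) and Prop. 3.2] -/
theorem KarlinRinott1980_prop_3_2_lintegral {n : ℕ} (ν : Measure ℝ) [SFinite ν]
    {f : (Fin (n + 1) → ℝ) → ℝ} (hfm : Measurable f) (hf0 : ∀ x, 0 ≤ f x) (hf : IsMTP2 f)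
    (i : Fin (n + 1)) (y z : Fin n → ℝ) :
    (∫⁻ t, ENNReal.ofReal (f (Fin.insertNth i t y)) ∂ν) *
        (∫⁻ t, ENNReal.ofReal (f (Fin.insertNth i t z)) ∂ν) ≤
      (∫⁻ t, ENNReal.ofReal (f (Fin.insertNth i t (y ⊔ z))) ∂ν) *
        (∫⁻ t, ENNReal.ofReal (f (Fin.insertNth i t (y ⊓ z))) ∂ν) :=
  lmarginal_fkgCondition ν hfm.ennreal_ofReal (fun x y => by
    rw [← ENNReal.ofReal_mul (hf0 x), ← ENNReal.ofReal_mul (hf0 _)]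
    exact ENNReal.ofReal_le_ofReal (hf x y)) i y z

end Literature.Probability.LatticeModels

end
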